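import Summits.ValiantsHypothesis.ValiantsHypothesis.Theorems.LacunarySymmetroidMatrixDescartesCensusV20Box26
import Summits.ValiantsHypothesis.ValiantsHypothesis.Theorems.LacunarySymmetroidMatrixDescartesCensusBox000203071525Pos
import Summits.ValiantsHypothesis.ValiantsHypothesis.Theorems.LacunarySymmetroidMatrixDescartesCensusBox000203071526Pos
import Summits.ValiantsHypothesis.ValiantsHypothesis.Theorems.LacunarySymmetroidMatrixDescartesCensusBox000203071626Pos

/-!
# `MatrixDescartes` census — BOX26 COMPLETE in the kernel: `ζ(2,6; d) ≤ 19` for EVERY support of width `≤ 26`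

HONEST FRAMING.  Object-search cell `pub-symmetroid`; door-A item `DoorA26 = PosRootLawAt 2 6 19`
(stmt-ValiantsHypothesis-19979; OPEN, typed, never asserted).  Assembly (no new mathematics) that REMOVES THE RESIDUE from the box of record
`Census.doorA26_box26_sorted_of_not_mem_residue` (val-sym-door-p4 g3, p485410: every sorted support `0 = d₀ < ⋯ < d₅ ≤ 26` outside the six
residue supports `V20.box26Open` carries the `V = 20` row).  The six residue supports are engine-3 g15's former OPEN-CORE cells of the box;
each is now a kernel theorem by RANK ROWS (`4 × 4` would-be-Gram minors `= 0`, single-monomial dominations under Newton-cone LP bounds,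
val-sym-door-p1 g3's `m4split` pipeline): `Census.doorA26_on_0_2_3_7_15_25` / `…_0_10_18_22_23_25` (…Box000203071525Pos),
`Census.doorA26_on_0_2_3_7_15_26` / `…_0_11_19_23_24_26` (…Box000203071526Pos), and the last pair `Census.doorA26_on_0_2_3_7_16_26` /
`…_0_10_19_23_24_26` (…Box000203071626Pos, val-sym-door-p4 g9; engine-3 g15's T5 minor `−M4(0235|1345)`).  Results:
`Census.V20.box26Open_rows` (the residue list carries the row), `Census.doorA26_box26_sorted` (sorted form, NO exception list),
`Census.doorA26_box26` (window form: any `d : Fin 6 → ℕ` with `d i ≤ d j + 26` for all `i, j`), and the bookkeeping equivalence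
`Census.doorA26_iff_width_27` (door A ⟺ its restriction to supports of width `≥ 27`: a hypothetical twenty needs `d₅ − d₀ ≥ 27`).
`V = 20` layer on a finite box only.  Nothing here bears on `V = 19`, on `ζ_sym(2,6)` over all supports (registers unchanged), on `DoorA26`
itself (OPEN), on `MatrixDescartes` (stmt-ValiantsHypothesis-18050) or on `VP ≠ VNP`.

[folklore] Bookkeeping over kernel rows; elementary.
-/

-- the D-0017 layout repeats a namespace component (single-conjunct summit); the `dupNamespace` linter flags it; name mandated.
set_option linter.dupNamespace false

namespace Summit.ValiantsHypothesis.ValiantsHypothesis.Theorems.LacunarySymmetroidMatrixDescartes.Census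

open Summit.ValiantsHypothesis.ValiantsHypothesis.Theorems.MatrixDescartes.Negative (PosRootLawAt)

/-- **The residue list carries the row**: each of the six supports of `V20.box26Open` — `(0,2,3,7,15,25)`, `(0,2,3,7,15,26)`, `(0,2,3,7,16,26)`
and their mirrors `(0,10,18,22,23,25)`, `(0,10,19,23,24,26)`, `(0,11,19,23,24,26)` — satisfies `ζ(2,6; d) ≤ 19`, by the rank-row closures
`Census.doorA26_on_<d>` of the tree. [folklore] -/
theorem V20.box26Open_rows : ∀ v ∈ V20.box26Open, PosRootLawOn 2 6 19 (fun i : Fin 6 => v.getD i.val 0) := by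
  intro v hv
  simp only [V20.box26Open, List.mem_cons, List.not_mem_nil, or_false] at hv
  rcases hv with rfl | rfl | rfl | rfl | rfl | rfl
  · have e : (fun i : Fin 6 => [0,2,3,7,15,25].getD i.val 0) = (![0, 2, 3, 7, 15, 25] : Fin 6 → ℕ) := by
      funext i; fin_cases i <;> rfl
    rw [e]; exact doorA26_on_0_2_3_7_15_25
  · have e : (fun i : Fin 6 => [0,2,3,7,15,26].getD i.val 0) = (![0, 2, 3, 7, 15, 26] : Fin 6 → ℕ) := by
      funext i; fin_cases i <;> rfl
    rw [e]; exact doorA26_on_0_2_3_7_15_26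
  · have e : (fun i : Fin 6 => [0,2,3,7,16,26].getD i.val 0) = (![0, 2, 3, 7, 16, 26] : Fin 6 → ℕ) := by
      funext i; fin_cases i <;> rfl
    rw [e]; exact doorA26_on_0_2_3_7_16_26
  · have e : (fun i : Fin 6 => [0,10,18,22,23,25].getD i.val 0) = (![0, 10, 18, 22, 23, 25] : Fin 6 → ℕ) := by
      funext i; fin_cases i <;> rfl
    rw [e]; exact doorA26_on_0_10_18_22_23_25
  · have e : (fun i : Fin 6 => [0,10,19,23,24,26].getD i.val 0) = (![0, 10, 19, 23, 24, 26] : Fin 6 → ℕ) := by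
      funext i; fin_cases i <;> rfl
    rw [e]; exact doorA26_on_0_10_19_23_24_26
  · have e : (fun i : Fin 6 => [0,11,19,23,24,26].getD i.val 0) = (![0, 11, 19, 23, 24, 26] : Fin 6 → ℕ) := by
      funext i; fin_cases i <;> rfl
    rw [e]; exact doorA26_on_0_11_19_23_24_26

/-- **BOX26 COMPLETE, sorted form (kernel)**: every real symmetric `2 × 2` six-term pencil on a sorted support `0 = d₀ < ⋯ < d₅ ≤ 26` has at most
`19` distinct positive roots of its determinant — `Census.doorA26_box26_sorted_or_residue` (box minus residue, p485410) joined with the six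
rank-row closures of the residue (`V20.box26Open_rows`).  No exception list remains on the box `d₅ − d₀ ≤ 26`. [folklore] -/
theorem doorA26_box26_sorted (d : Fin 6 → ℕ) (hd : StrictMono d) (h0 : d 0 = 0) (h5 : d 5 ≤ 26) : PosRootLawOn 2 6 19 d := by
  rcases doorA26_box26_sorted_or_residue d hd h0 h5 with h | hmem
  · exact h
  · have key := V20.box26Open_rows _ hmem
    have e : (fun i : Fin 6 => [d 0, d 1, d 2, d 3, d 4, d 5].getD i.val 0) = d := by
      funext i; fin_cases i <;> rfl
    rw [e] at key
    exact key

/-- **BOX26 for arbitrary exponent vectors (kernel)**: any `d : Fin 6 → ℕ` whose entries lie in a window of width `26` (`d i ≤ d j + 26` for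
all `i, j`) satisfies the door-A row `ζ(2,6; d) ≤ 19` — repeated exponents by the support's Descartes count, distinct ones by sorting
(`posRootLawOn_comp_equiv_iff`), translating to `d₀ = 0` (`posRootLawOn_add_const_iff`) and `doorA26_box26_sorted`.  Extends `doorA26_box24`
(p485336) and `doorA26_box20` (p410881): a hypothetical twenty needs `d₅ − d₀ ≥ 27`. [folklore] -/
theorem doorA26_box26 (d : Fin 6 → ℕ) (hw : ∀ i j, d i ≤ d j + 26) : PosRootLawOn 2 6 19 d := by
  classical
  by_cases hinj : Function.Injective d
  · set σ := Tuple.sort d with hσ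
    have hmono : Monotone (d ∘ σ) := Tuple.monotone_sort d
    have hsm : StrictMono (d ∘ σ) := hmono.strictMono_of_injective (hinj.comp σ.injective)
    set m := (d ∘ σ) 0 with hm
    have hmle : ∀ l, m ≤ (d ∘ σ) l := fun l => hmono (Fin.zero_le l)
    set e : Fin 6 → ℕ := fun l => (d ∘ σ) l - m with he
    have hde : (d ∘ σ) = fun l => e l + m := by
      funext l; simp only [he]; have := hmle l; omega
    have he_mono : StrictMono e := by
      intro a b hab; simp only [he]; have := hsm hab; have := hmle a; omega
    have he0 : e 0 = 0 := by simp [he, hm]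
    have he5 : e 5 ≤ 26 := by
      simp only [he]
      have := hw (σ 5) (σ 0)
      simp only [hm, Function.comp] at this ⊢
      omega
    have hrow : PosRootLawOn 2 6 19 e := doorA26_box26_sorted e he_mono he0 he5
    have hrow' : PosRootLawOn 2 6 19 (d ∘ σ) := by
      rw [hde]; exact (posRootLawOn_add_const_iff e m).mpr hrow
    exact (posRootLawOn_comp_equiv_iff σ d).mpr hrow'
  · exact fun S _ => posRoots_two_le_of_card_pairSums (by norm_num) d (card_pairSums_le_of_not_injective d hinj) S

/-- **Bookkeeping corollary — door A is equivalent to its restriction to the WIDE supports**: `DoorA26` (= `PosRootLawAt 2 6 19`, the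
census-side name of the typed item `Theses.LacunarySymmetroid.DoorA26`; the two agree by `Iff.rfl`, `Census.doorA26_item_iff` in …CensusDoorA26Link) holds iff every exponent vector of width at
least `27` (some `d i ≥ d j + 27`) carries the row `ζ(2,6; d) ≤ 19`; the narrow supports are `doorA26_box26`.  A reduction only: the
right-hand side is OPEN and nothing is claimed about it (a hypothetical twenty needs `d₅ − d₀ ≥ 27`). [folklore] -/
theorem doorA26_iff_width_27 :
    DoorA26 ↔ ∀ d : Fin 6 → ℕ, (∃ i j, d j + 27 ≤ d i) → PosRootLawOn 2 6 19 d := by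
  refine ⟨fun h d _ => h d, fun h => ?_⟩
  intro d
  by_cases hw : ∀ i j, d i ≤ d j + 26
  · exact doorA26_box26 d hw
  · push Not at hw
    obtain ⟨i, j, hij⟩ := hw
    exact h d ⟨i, j, by omega⟩

end Summit.ValiantsHypothesis.ValiantsHypothesis.Theorems.LacunarySymmetroidMatrixDescartes.Census
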